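import Summits.AnomalousDissipation.AnomalousDissipation.Theorems.MomentParityMomentLadderKBResolved
import Summits.AnomalousDissipation.AnomalousDissipation.Theorems.MomentParityGalerkinInvariantLoudStubEnergyFloor
import Summits.AnomalousDissipation.AnomalousDissipation.Theorems.MomentParityGalerkinInvariantLoudStubTaylorReduction

/-!
# Crux `MomentParity.MomentLadder` (stmt-AnomalousDissipation-11463), line `Sketch`: the ONE-TRAJECTORY RESOLVED TAYLOR
# currency — `T_res → MomentLadder`

The sibling crux `GalerkinInvariantLoud` (stmt-14283) has been reduced by its line `taylor-cone-homogenisation` (S1–S3 landed: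
`EnergyFloor.stub_energyFloor`, `TaylorReduction.stub_taylorReduction`, `KrylovBogoliubov.stub_krylovBogoliubov`) to the
one-trajectory statement `stub_oneTrajectoryTaylor`: per `(j, N)` ONE mean-zero Galerkin datum whose orbit has cumulative Taylor
ratio `liminf_T ν_j∫₀ᵀ‖∇u‖² / ∫₀ᵀ|u|² ≥ κ`. The crux `MomentLadder` = `GalerkinInvariantLoud` + `N`-uniform resolution of the
dissipation (line `Sketch`: `galerkinInvariantLoudUI_iff_MomentLadder`, `galerkinInvariantLoud_of_MomentLadder`). This file
states the crux's residual in the SAME one-trajectory currency and proves the transfer: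

* `MomentLadder_of_oneTrajectoryResolved` — **T_res ⟹ MomentLadder**, where T_res := the body of `stub_oneTrajectoryTaylor`
  verbatim PLUS, at every `j`, a schedule `K_j` with `limsup_T T⁻¹∫₀ᵀ (‖∇u‖² − ‖∇P_{K_j n}u‖²) dt ≤ 1/(n+1)` for all `n`
  (the time-averaged enstrophy of the run is resolved by the modes `|k| ≤ K_j(n)` up to `1/(n+1)`, UNIFORMLY IN THE LEVEL `N`:
  the converged-DNS clause, Kaneda et al. 2003). Proof: `krylovBogoliubov_resolved` (Cesàro cluster law: invariant, in the
  cone, absorbing ball, `K_j`-resolved) + energy floor + energy row, packaged by `momentLadder_iff`.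
* `oneTrajectoryTaylor_of_oneTrajectoryResolved` — T_res ⟹ the body of `stub_oneTrajectoryTaylor` (forget the schedule), so
  that, read together with the landed `galerkinInvariantLoud_of_MomentLadder`, the two cruxes' one-trajectory residuals differ
  EXACTLY by the spectral-convergence clause.

Companion (lead -1, landed): `MomentLadder_of_oneTrajectoryUI` (`Theorems/MomentParityMomentLadderTrajectoryCorner.lean`) is the
same entrance in the UI-modulus currency (time means of energy `≤ E`, dissipation `≥ ε`, tails `(Z − M)₊ ≤ ω_j M`); here the
window is replaced by ONE ratio `κ` (floor and ceiling become corollaries) and the modulus by the crux's own resolution clause.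

References: Krylov–Bogoliubov 1937; Foias–Manley–Rosa–Temam 2001, Ch. IV §2–3 and App. B; Doering–Foias 2002 §2;
Kaneda–Ishihara–Yokokawa–Itakura–Uno 2003 (doi:10.1063/1.1539855).
-/

set_option linter.dupNamespace false

noncomputable section

/-! ## The one-trajectory resolved Taylor form gives the crux -/

namespace Summit.AnomalousDissipation.AnomalousDissipation.Theorems.MomentLadder

open MeasureTheory Filter Topology Set UnitAddTorus
open scoped ENNReal InnerProductSpace RealInnerProductSpace
open Literature.Analysis.FunctionSpaces Literature.Analysis.FluidPDE
open Summit.AnomalousDissipation.AnomalousDissipation.Theses.MomentParity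
open Summit.AnomalousDissipation.AnomalousDissipation.Theorems.QuarticGate.Negative
open Summit.AnomalousDissipation.AnomalousDissipation.Theorems.MomentLadder.Negative (IsSupported IsResolved IsLadderWitness momentLadder_iff)
open Summit.AnomalousDissipation.AnomalousDissipation.Theorems.GalerkinInvariantLoud.EnergyFloor (stub_energyFloor)
open Summit.AnomalousDissipation.AnomalousDissipation.Theorems.GalerkinInvariantLoud.TaylorReduction (energy_le_of_cone integrable_norm_pow_of_ae_le)

/-- **`MomentLadder` from ONE RESOLVED TAYLOR TRAJECTORY per `(j, N)`** (the one-trajectory currency of the crux, transfer half).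
Hypothesis (`T_res`): a smooth divergence-free mean-zero force `f ≠ 0`, viscosities `ν_j → 0⁺`, ONE ratio `κ > 0`, and at every
`j` a resolution schedule `K_j : ℕ → ℕ` such that for infinitely many levels `N` some mean-zero Galerkin datum `a` of order `N`
has an orbit `u(t) = galerkinFlow ν_j f N t a` with
* cumulative Taylor ratio `liminf_T ν_j∫₀ᵀ‖∇u‖² / ∫₀ᵀ|u|² ≥ κ` (verbatim the open stub `stub_oneTrajectoryTaylor` of the sibling
  crux `GalerkinInvariantLoud`, line `taylor-cone-homogenisation`), and
* `N`-UNIFORMLY RESOLVED time-averaged enstrophy: `limsup_T T⁻¹∫₀ᵀ (‖∇u‖² − ‖∇P_{K_j n}u‖²) ≤ 1/(n+1)` for every `n` (the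
  converged-DNS clause: no pile-up of the dissipation spectrum at the truncation shell, uniformly in the resolution).
Conclusion: `MomentParity.MomentLadder` BY NAME. Proof: `krylovBogoliubov_resolved` turns each orbit into an all-order invariant
level-`N` law in the cone `κ e ≤ D`, supported in the absorbing ball `R_j = ‖f‖₂/(4π²ν_j)` and `K_j`-resolved; the landed energy
floor (`EnergyFloor.stub_energyFloor`: `e ≥ e₀(f)` once `ν_j ≤ ν₀`, `N ≥ N₀`) and the energy row (`D ≤ ‖f‖₂√e`) convert the
cone into the window `e ≤ ‖f‖₂²/κ²`, `D ≥ κ e₀` after re-indexing the viscosities past `ν₀`; `momentLadder_iff` packages the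
clauses (the same law serves every order `d`). [folklore] -/
theorem MomentLadder_of_oneTrajectoryResolved :
    (∃ f : UnitAddTorus (Fin 3) → EuclideanSpace ℝ (Fin 3),
      Torus.IsSmooth f ∧ Torus.IsDivFree f ∧ Torus.HasZeroMean f ∧ f ≠ 0 ∧
      ∃ (ν : ℕ → ℝ) (κ : ℝ), (∀ j, 0 < ν j) ∧ Tendsto ν atTop (𝓝 0) ∧ 0 < κ ∧
        ∀ j : ℕ, ∃ K : ℕ → ℕ, ∃ᶠ N in atTop, ∃ a : UnitAddTorus (Fin 3) → EuclideanSpace ℝ (Fin 3),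
          IsGalerkinMode N a ∧ Torus.HasZeroMean a ∧
          κ ≤ Filter.liminf (fun T : ℝ =>
            (ν j * (∫⁻ t in Ioo 0 T, Torus.eGradNormSq (Torus.galerkinFlow (ν j) f N t a)).toReal) /
              (∫ t in (0 : ℝ)..T, ∫ x, ‖Torus.galerkinFlow (ν j) f N t a x‖ ^ 2)) atTop ∧
          ∀ n : ℕ, Filter.limsup (fun T : ℝ => (ENNReal.ofReal T)⁻¹ *
            ∫⁻ t in Ioo 0 T, (Torus.eGradNormSq (Torus.galerkinFlow (ν j) f N t a) -
              Torus.eGradNormSq (Torus.fourierTruncate (K n) (Torus.galerkinFlow (ν j) f N t a)))) atTop ≤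
            ((n : ℝ≥0∞) + 1)⁻¹) →
    MomentLadder := by
  rintro ⟨f, hfs, hfd, hfz, hf0, ν, κ, hν, hν0, hκ, hj⟩
  -- (floor) the thresholds of the landed energy floor for this force
  obtain ⟨e₀, ν₀, he₀, hν₀, N₀, hfloor⟩ := stub_energyFloor f hfs hfd hfz hf0
  -- (re-index) `ν_j → 0` gives `J` with `ν_j ≤ ν₀` for `j ≥ J`
  obtain ⟨J, hJ⟩ : ∃ J : ℕ, ∀ j ≥ J, ν j ≤ ν₀ :=
    eventually_atTop.1 (hν0.eventually (eventually_le_nhds hν₀))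
  refine momentLadder_iff.2 ⟨f, hfs, hfd, hfz, fun j => ν (j + J), (∫ x, ‖f x‖ ^ 2) / κ ^ 2, κ * e₀,
    fun j => hν (j + J), hν0.comp (tendsto_add_atTop_nat J), mul_pos hκ he₀, fun j => ?_⟩
  obtain ⟨K, hK⟩ := hj (j + J)
  refine ⟨Real.sqrt (∫ x, ‖f x‖ ^ 2) / (4 * Real.pi ^ 2 * ν (j + J)), K,
    (hK.and_eventually (eventually_ge_atTop N₀)).mono ?_⟩
  rintro N ⟨⟨a, ha, ha0, hlim, hres⟩, hN⟩ d
  obtain ⟨μ, hp, hl, hRμ, hinv, hcone, hresμ⟩ :=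
    krylovBogoliubov_resolved (ν (j + J)) f N κ K a (hν (j + J)) hfs hfz ha ha0 hlim hres
  haveI := hp
  have h2 : Integrable (fun u : Torus.energySpace (Fin 3) => ‖u‖ ^ 2) μ := integrable_norm_pow_of_ae_le hRμ 2
  have he : 0 ≤ Torus.ensembleEnergy μ := integral_nonneg fun u => by positivity
  -- (ceiling) the energy row `D ≤ ‖f‖₂ √e` from 3-stationarity
  have hceil : Torus.ensembleDissipation (ν (j + J)) μ ≤
      Real.sqrt (∫ x, ‖f x‖ ^ 2) * Real.sqrt (Torus.ensembleEnergy μ) :=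
    ensembleDissipation_le_of_polyStationary f (hfs.memLp 2) hl h2 le_rfl (hinv 3)
  -- (loud) the energy floor `e₀ ≤ e` from 2-stationarity at `0 < ν (j + J) ≤ ν₀`, `N₀ ≤ N`
  have hfl : e₀ ≤ Torus.ensembleEnergy μ :=
    hfloor (ν (j + J)) (hν (j + J)) (hJ (j + J) (Nat.le_add_left J j)) N hN μ hp hl h2 (hinv 2)
  refine ⟨μ, hp, hl, hRμ, hresμ, hinv d, ?_, ?_⟩
  · exact energy_le_of_cone hκ he (integral_nonneg fun x => by positivity) (hcone.trans hceil)
  · calc κ * e₀ ≤ κ * Torus.ensembleEnergy μ := mul_le_mul_of_nonneg_left hfl hκ.le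
      _ ≤ Torus.ensembleDissipation (ν (j + J)) μ := hcone

/-- **The one-trajectory resolved Taylor form implies the open stub `stub_oneTrajectoryTaylor` of the sibling crux
`GalerkinInvariantLoud` (line `taylor-cone-homogenisation`) verbatim** — forget the schedule: the crux `MomentLadder`'s
one-trajectory residual is the sibling crux's one-trajectory residual PLUS the spectral-convergence clause. [folklore] -/
theorem oneTrajectoryTaylor_of_oneTrajectoryResolved
    (h : ∃ f : UnitAddTorus (Fin 3) → EuclideanSpace ℝ (Fin 3),
      Torus.IsSmooth f ∧ Torus.IsDivFree f ∧ Torus.HasZeroMean f ∧ f ≠ 0 ∧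
      ∃ (ν : ℕ → ℝ) (κ : ℝ), (∀ j, 0 < ν j) ∧ Tendsto ν atTop (𝓝 0) ∧ 0 < κ ∧
        ∀ j : ℕ, ∃ K : ℕ → ℕ, ∃ᶠ N in atTop, ∃ a : UnitAddTorus (Fin 3) → EuclideanSpace ℝ (Fin 3),
          IsGalerkinMode N a ∧ Torus.HasZeroMean a ∧
          κ ≤ Filter.liminf (fun T : ℝ =>
            (ν j * (∫⁻ t in Ioo 0 T, Torus.eGradNormSq (Torus.galerkinFlow (ν j) f N t a)).toReal) /
              (∫ t in (0 : ℝ)..T, ∫ x, ‖Torus.galerkinFlow (ν j) f N t a x‖ ^ 2)) atTop ∧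
          ∀ n : ℕ, Filter.limsup (fun T : ℝ => (ENNReal.ofReal T)⁻¹ *
            ∫⁻ t in Ioo 0 T, (Torus.eGradNormSq (Torus.galerkinFlow (ν j) f N t a) -
              Torus.eGradNormSq (Torus.fourierTruncate (K n) (Torus.galerkinFlow (ν j) f N t a)))) atTop ≤
            ((n : ℝ≥0∞) + 1)⁻¹) :
    ∃ f : UnitAddTorus (Fin 3) → EuclideanSpace ℝ (Fin 3),
      Torus.IsSmooth f ∧ Torus.IsDivFree f ∧ Torus.HasZeroMean f ∧ f ≠ 0 ∧
      ∃ (ν : ℕ → ℝ) (κ : ℝ), (∀ j, 0 < ν j) ∧ Tendsto ν atTop (𝓝 0) ∧ 0 < κ ∧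
        ∀ j : ℕ, ∃ᶠ N in atTop, ∃ a : UnitAddTorus (Fin 3) → EuclideanSpace ℝ (Fin 3),
          IsGalerkinMode N a ∧ Torus.HasZeroMean a ∧
          κ ≤ Filter.liminf (fun T : ℝ =>
            (ν j * (∫⁻ t in Ioo 0 T, Torus.eGradNormSq (Torus.galerkinFlow (ν j) f N t a)).toReal) /
              (∫ t in (0 : ℝ)..T, ∫ x, ‖Torus.galerkinFlow (ν j) f N t a x‖ ^ 2)) atTop := by
  obtain ⟨f, hfs, hfd, hfz, hf0, ν, κ, hν, hν0, hκ, hj⟩ := h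
  refine ⟨f, hfs, hfd, hfz, hf0, ν, κ, hν, hν0, hκ, fun j => ?_⟩
  obtain ⟨K, hK⟩ := hj j
  exact hK.mono fun N ⟨a, ha, ha0, hlim, _⟩ => ⟨a, ha, ha0, hlim⟩

end Summit.AnomalousDissipation.AnomalousDissipation.Theorems.MomentLadder

end
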